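import Mathlib
import HarnessLib
import HarnessLib.Audit
import Summits.NavierStokesRegularity.Statement
import Literature.Analysis.FluidPDE.ClassicalSolution
import Literature.Analysis.FluidPDE.LerayHopf
import Literature.Analysis.FluidPDE.NSWave0
import Literature.Analysis.FunctionSpaces.TorusFluidGlue
import Summits.NavierStokesRegularity.NavierStokesRegularity.Theorems.AdiabaticEddyClayUniqueness
import HarnessLib.Audit.Status.Attr

/-!
Route: RobustBlowupPortability

DORMANT since 2026-09-01T22:40:03Z (reconciler: no traction for 5 d (last activity statement-closed at 2026-08-27T21:50:07Z); parked, not closed — `ledger route dormant route-NavierStokesRegularity-RobustBlowupPortability --off` to reac) — unstaffed, not closed; items shared with open routes are served there. `ledger route dormant <id> --off` reactivates.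

# Route RobustBlowupPortability — robust torus blow-up is portable to Schwartz data on R^3 by
transplanting the hypothetical global R^3 flow back into the torus

NEGATIVE side (target ¬NavierStokesRegularity), realising card robust-blowup-portability. It
suffices to show X = S ∧ X5b where
S (ROBUST TORUS SCENARIO) = there are ν>0, a core cube {dist y c₀ < r} ⊂ 𝕋³ (r ≤ 1/8), an order k
and bounds A : ℕ → ℝ, E such that for
every horizon τ>0 and every forcing size M there is a smooth divergence-free datum V₁ on 𝕋³ = ℝ³/ℤ³
with energy ≤ E and all derivatives
bounded by A j off the inner cube {dist < r/2} which is (r,τ,k,M)-ROBUSTLY SINGULAR: no classical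
solution of the FORCED Navier–Stokes
system on 𝕋³×[0,τ] starts from V₁ with a forcing that vanishes identically on the core cube and is
Cᵏ-bounded by M elsewhere (sup in t).
(Intended witnesses: late-time slices v(t₁) of a periodic blow-up whose mechanism is stable modulo
symmetries; a bounded physical forcing
is O(M(T−t)^{2−β}) = O(e^{−(2−β)s}) in similarity variables, so robustness is what any
modulation/CAP proof must deliver anyway.)
X5b = Clay-class uniqueness, verbatim stmt-NavierStokesRegularity-0153 (shared with routes
Blowup/CertifiedBlowup/DssFarFieldSlaving).
The route's own analytic content is the bridge S ⇒ X5a (cruxes #2 TorusPortabilityLemma and #3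
LocalSmoothingNearInitialTime); the
assembly S → (#2) → (#3) → X5b → ¬NavierStokesRegularity is formal (instantiate, then the proved
Literature.NS.blowup_assembly) and is
proved in the planner's Sketch.lean (lean check rc 0).
Lean: `(∃ ν : ℝ, 0 < ν ∧ ∃ (c₀ : UnitAddTorus (Fin 3)) (r : ℝ), 0 < r ∧ r ≤ 1 / 8 ∧ ∃ (k : ℕ) (A : ℕ
→ ℝ) (E : ℝ), ∀ τ : ℝ, 0 < τ → ∀ M : ℝ, ∃ V₁ : UnitAddTorus (Fin 3) → EuclideanSpace ℝ (Fin 3),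
Literature.Analysis.FunctionSpaces.Torus.IsSmooth V₁ ∧
Literature.Analysis.FunctionSpaces.Torus.IsDivFree V₁ ∧
Literature.Analysis.FunctionSpaces.Torus.kineticEnergy V₁ ≤ E ∧ (∀ (j : ℕ) (x : EuclideanSpace ℝ
(Fin 3)), r / 2 ≤ dist (Literature.Analysis.FunctionSpaces.Torus.proj x) c₀ → ‖iteratedFDeriv ℝ j
(Literature.Analysis.FunctionSpaces.Torus.lift V₁) x‖ ≤ A j) ∧ ∀ (f w : ℝ → UnitAddTorus (Fin 3) →
EuclideanSpace ℝ (Fin 3)) (q : ℝ → UnitAddTorus (Fin 3) → ℝ),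
Literature.Analysis.FunctionSpaces.Torus.IsClassicalNSSolutionOn (Set.Icc 0 τ) ν f w q → w 0 = V₁ →
(∀ t ∈ Set.Icc 0 τ, Literature.Analysis.FunctionSpaces.Torus.IsSmooth (f t)) → (∀ t ∈ Set.Icc 0 τ, ∀
y : UnitAddTorus (Fin 3), dist y c₀ < r → f t y = 0) → (∀ t ∈ Set.Icc 0 τ, ∀ j ≤ k, ∀ x :
EuclideanSpace ℝ (Fin 3), ‖iteratedFDeriv ℝ j (Literature.Analysis.FunctionSpaces.Torus.lift (f t))
x‖ ≤ M) → False) ∧ (∀ ν : ℝ, 0 < ν → ∀ (u₀ : EuclideanSpace ℝ (Fin 3) → EuclideanSpace ℝ (Fin 3)),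
Literature.Analysis.FluidPDE.HasRapidSpatialDecay u₀ → ∀ (u v : ℝ → EuclideanSpace ℝ (Fin 3) →
EuclideanSpace ℝ (Fin 3)) (p q : ℝ → EuclideanSpace ℝ (Fin 3) → ℝ) (T : ℝ), 0 < T →
Literature.Analysis.FluidPDE.IsSmoothOnHalfSpace u →
Literature.Analysis.FluidPDE.IsSmoothOnHalfSpace p →
Literature.Analysis.FluidPDE.IsNavierStokesSolution ν 0 u₀ u p →
Literature.Analysis.FluidPDE.HasBoundedEnergy u →
Literature.Analysis.FluidPDE.IsClassicalNSSolutionOn (Set.Ico 0 T) ν 0 v q →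
Literature.Analysis.FluidPDE.IsLerayHopfOn T ν 0 u₀ v → v 0 = u₀ → ∀ t ∈ Set.Ico 0 T, u t = v t)`

## Assembly
Pure logic plus the proved glue: from RobustTorusScenario take (ν,c₀,r,k,A,E); TorusPortabilityLemma
applied to LocalSmoothingNearInitialTime
gives (τ,M); the scenario gives an admissible robustly singular V₁; the lemma gives X5a;
Literature.NS.blowup_assembly ⟨X5a, X5b⟩ refutes
NavierStokesRegularity. Proved verbatim in the planner's Sketch.lean (`assembly_holds_sketch`, lean
check rc 0) — closable at once.

UNDER FLOOR: fewer than 2 cruxes remain after retriage (legacy route; D-0019).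

Rationale: WHY THIS LINE. Certified or modulation-based blow-up constructions live in CONTAINERS (𝕋³,
periodic/slip cylinders: Hou arXiv:2107.06509, the T³ CAP
claim arXiv:2604.09949, Kida-type high-symmetry flows) while the summit is Clay (A) on ℝ³ with
Schwartz data; finite speed of propagation is
false and the pressure is non-local, and the only printed transfer (Tao2011 = arXiv:1108.1165, Thm
1.20(ii)/(iii) and Remark 81) turns a
periodic singularity into a FORCED non-periodic one ("we were unable to obtain this converse
implication in the inhomogeneous case"). The
mechanism here removes the forcing by putting the burden where constructions can carry it:
ROBUSTNESS of the singular datum against bounded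
exterior forcing (S), and it proves the transfer without ever comparing two flows — assume the ℝ³
solution u from the truncated datum
u₀ = (V₁ on the cube, Bogovskiĭ-corrected cut-off outside) is global, bound u in the collar
uniformly up to the initial time by local-in-space
regularity near t = 0 (JiaSverak2014 = arXiv:1204.0529 Thms 3.1–3.2 and the higher-order bound in
the proof of Thm 4.1; BarkerPrange2020 =
arXiv:1812.09115 Thm 1; constants depend on collar norms and the ENERGY only, the core being
arbitrary), and TRANSPLANT u back into 𝕋³ as
w = χu + (1−χ)V₁ + (div-free collar correction), pressure χ̃p: (w, χ̃p) is a classical forced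
solution with forcing ≡ 0 on the core cube,
Cᵏ-bounded in the collar by a constant M₀(ν,r,k,A,E) independent of how singular V₁ is inside, and
w(0) = V₁ exactly — contradicting S.
Imported: local regularity theory of suitable/local-energy solutions (ε-regularity near initial
time) from the Lemarié-Rieusset/Jia–Šverák
school, and the robustness-as-currency idea of Elgindi–Ghoul–Masmoudi arXiv:1910.14071 (stable
self-similar Euler blow-up ⇒ compactly
supported blow-up). What no prior route does: CertifiedBlowup leaves LOCALISATION informal
(stmt-0271), DssFarFieldSlaving truncates an
infinite-energy DSS profile in Gaussian spaces (different object); here the container change itself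
is typed and reduced to two lemmas.

RANKED CRUXES. #2 TorusPortabilityLemma (crux) — (local smoothing near the initial time, = the
statement of #3) → for all ν>0, core cube (c₀, r ≤ 1/8), order k, collar bounds A and energy E there
are a horizon τ>0 and a forcing size M such that every smooth divergence-free torus datum V₁ with
energy ≤ E and derivatives ≤ A j off the inner cube which is (r,τ,k,M)-robustly singular yields X5a
(a maximal classical Leray–Hopf solution on ℝ³×[0,T), T<∞, from a rapidly decaying datum). Proof
plan: contrapositive via support GlobalFromNoBlowup (¬X5a ⇒ global classical solutions on closed
slabs from the C_c^∞ truncation u₀ of the lift of V₁, support DivFreeTruncation), collar bounds from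
the hypothesis (#3) with (A',E') computed from (A,E,r), transplant w = χu♭ + (1−χ)V₁ + b (b a
divergence-free collar correction of ∇χ·(u♭−V₁), vanishing at t=0), pressure χ̃p♭: forcing f := ∂ₜw
+ (w·∇)w − νΔw + ∇(χ̃p♭) is ≡ 0 on {χ = 1} ⊇ core cube and Cᵏ-bounded by M₀(ν,r,k,A,E) on [0,τ];
w(0) = V₁; contradiction with robust singularity. Card items (P2) far-field bookkeeping and (P3)
glue live here; (R) is the hypothesis. [deps: LocalSmoothingNearInitialTime, GlobalFromNoBlowup,
DivFreeTruncation] [difficulty: L] (why it might fail: Collar forcing must be bounded by (ν,r,k,A,E)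
alone: uses ∇p_far ≲ E r⁻⁴ (energy only) and SPATIAL Cᵏ bounds only (∂ₜ∇p_far would need ∫|u|³,
unbounded near a blow-up); dies if exact datum matching w(0)=V₁ or the t↓0-uniform collar bounds
cannot be arranged.) [arXiv:1108.1165 (Tao2011 Thm 1.20 and Rmk 81), arXiv:1204.0529 (JiaSverak2014
Thms 3.1-3.2 and proof of Thm 4.1), arXiv:1910.14071, arXiv:1812.09115, Galdi2011 III.3 (Bogovskii)]
#3 LocalSmoothingNearInitialTime (crux) — LOCAL-IN-SPACE REGULARITY NEAR THE INITIAL TIME,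
higher-order form (Jia–Šverák): for ν>0, radius ρ, order k, local bounds A : ℕ → ℝ and energy E
there are τ>0 and M such that every classical solution (u,p) of unforced NS on ℝ³×[0,T'], Leray–Hopf
from its rapidly decaying datum u(0), with ∫|u(0)|² ≤ E and |Dʲu(0)| ≤ A j on B(x₀,2ρ) for all j,
satisfies |Dʲu(t,x)| ≤ M and |Dʲ∇p(t,x)| ≤ M for j ≤ k, x ∈ B(x₀,ρ), t ∈ [0, min(τ,T')] — constants
uniform in x₀ and in the solution. In print: JS14 Thm 3.2 (C^γ_par up to t=0, T = T(α,γ,M)) and, for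
all derivatives incl. one ∂ₜ, the bound ‖∂ₜ∂ₓ^α u‖_{L∞(B_{1/8}(x₀)×[0,T₂])} ≤ C(α,u₀) asserted in
the proof of Thm 4.1 (arXiv text p. 9) for local Leray solutions with u₀ smooth in B₄(x₀); ν, ρ by
scaling; the ∇p clause from ∇p = −∂ₜu − (u·∇)u + νΔu or from the near/far split of the normalised
pressure (tao_pressure_normalisation_holds, proved in-tree) with |Dᵐ∇p_far| ≲ E·dist^{-4-m}.
Expected discharge: vendor JS14 Thms 3.1/3.2 (+ the bootstrapped higher-order estimate) as a named
fact (cite item filed) and reduce; or prove along JS14 using the in-tree local-Leray/CKN facts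
(jia_sverak_2013_lemma_2, CKN files). [difficulty: L] (why it might fail: Printed at Hölder level
(JS14 Thm 3.2); the all-orders bound up to t=0 is only claimed inside a proof ('simple
bootstrapping', arXiv:1204.0529 p.9); we also need constants uniform in x₀ depending on the datum
only via (A,E), general ν, ρ and the ∇p clause — a gap in print rather than in truth.)
[arXiv:1204.0529 (JiaSverak2014 Thm 3.1 / Thm 3.2 / proof of Thm 4.1 p.9), arXiv:1812.09115
(BarkerPrange2020 Thm 1), arXiv:1812.10509 (KangMiuraTsai2021), arXiv:1201.1592 (JiaSverak2013 Lemma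
2 = jia_sverak_2013_lemma_2)]
#4 RobustTorusScenario (crux) — S of the thesis: ∃ ν>0, core cube (c₀, r ≤ 1/8), k, A, E such that ∀
τ>0 ∀ M ∃ a smooth divergence-free torus datum V₁ (energy ≤ E, |Dʲ lift V₁| ≤ A j off the inner cube
{dist < r/2}) that is (r,τ,k,M)-robustly singular. PRODUCER crux (open-problem difficulty; the exit
of every container construction): a periodic blow-up (¬Clay (B)-type statement) whose late slices
v(t₁), t₁ ↑ T, are the V₁ — energy ≤ E(0) by the energy equality, collar bounds A by isolatedness of
the singular point (CKN leaves a regular annulus; v and q bounded with all derivatives off the core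
up to T), and ROBUSTNESS from stability of the blow-up mechanism modulo symmetries: exterior forcing
of physical size M reaches the core only through a harmonic pressure gradient ∇Δ⁻¹div f and
advection over the vanishing time T−t₁, i.e. as an O((M+E)(T−t)^{2−β}) = O(e^{−(2−β)s}) perturbation
in similarity variables (β = ½ for Leray scaling: e^{−3s/2}). By NS scaling one compactly supported
robustly singular torus datum generates the whole (τ,M)-family. Candidate producers:
CertifiedBlowup-type CAP certificates on 𝕋³ (arXiv:2604.09949, unrefereed), Kida/high-symmetric
scenarios, viscosity-selected-singularity / dimension-ladder cards; Hou's cylinder scenario needs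
the slip-cylinder analogue (definition request). [difficulty: open-problem] (why it might fail:
Needs a periodic blow-up at all (Clay (B) may hold) AND stability of its mechanism against
ADVERSARIAL bounded exterior forcing: a finite-codimension or merely symmetry-protected profile is
kicked off its stable manifold by the O(M e^{-(2-β)s}) pressure signal at finite log-time, before
T.) [arXiv:2107.06509 (Hou2022PotentiallySingularNS), ChenHou2025, arXiv:2604.09949,
arXiv:1910.14071 (EGM stability => localisation), MerleZaag1997 (stability of the blow-up profile
for semilinear heat), Fefferman2000 (Clay (B)/(D))]
#9 GlobalFromNoBlowup (support) — ¬X5a ⇒ for every ν>0, every smooth divergence-free rapidly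
decaying datum u₀ on ℝ³ and every T>0 there is a classical solution (u,p) on the CLOSED slab [0,T],
Leray–Hopf from u₀, u(0) = u₀. Continuation bookkeeping: local classical existence on closed slabs
(tao2011_smooth_local_existence_holds / Fluid.local_classical_lerayHopf, proved in-tree),
weak–strong uniqueness (serrin_weak_strong_uniqueness_holds) to make extensions compatible, gluing
(IsClassicalNSSolutionOn.glue), and ¬X5a = every classical LH solution from a decaying datum extends
past its endpoint (cf. stmt-NavierStokesRegularity-0730: X5a ↔ ¬NoBlowup); a sup argument gives
[0,T]. [difficulty: M] [arXiv:1108.1165 (Tao2011 Thm 5.4 and Cor 11.1), Leray1934,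
BealeKatoMajda1984]
#9 DivFreeTruncation (support) — Divergence-free truncation with collar control (Bogovskiĭ / cut
vector potential): for ρ>0 and bounds A, E there is C : ℕ → ℝ such that every smooth divergence-free
V on ℝ³ with ∫_{B(x₀,2ρ)}|V|² ≤ E and |DʲV| ≤ A j on the shell ρ/2 ≤ |x−x₀| ≤ 2ρ admits a smooth
divergence-free u₀ with u₀ = V on B̄(x₀,ρ), u₀ = 0 off B(x₀,2ρ), and |Dʲu₀| ≤ C j for |x−x₀| ≥ ρ.
(u₀ = χV − Bog[∇χ·V] on the annulus, compatibility ∫∇χ·V = 0 from div V = 0; Galdi III.3; JS14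
footnote to Thm 3.1. No Bogovskiĭ operator is in the tree yet; a cut vector-potential construction,
where E enters, is an alternative.) Used by #2 for the ℝ³ datum and, with a time parameter, for the
collar correction b. [difficulty: M] [Galdi2011 III.3 (Bogovskii 1979), arXiv:1204.0529 (footnote to
Thm 3.1)]
#9 ClayUniqueness (support) — X5b, Clay-class uniqueness — verbatim stmt-NavierStokesRegularity-0153
(shared; being closed in route Blowup via Tao2011 Cor 11.4, stmt-0728): a Clay-class solution
(smooth on ℝ³×[0,∞), bounded energy) agrees on [0,T) with the classical Leray–Hopf solution from the
same rapidly decaying datum. [difficulty: M] [Fefferman2000, arXiv:1108.1165 (Tao2011 Lemma 4.1 and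
Cor 11.4), Prodi1959, Serrin1963]

TWO-LAYER PLAN. Foreseen glued splits (filed only after a crux moves): TorusPortabilityLemma ⇐ (P-a:
collar bounds for the ℝ³ flow and its pressure
gradient from #3 + energy, incl. the far-field estimate |Dᵐ∇p_far| ≤ C E r^{-4-m}) → (P-b: the
transplant (w, χ̃p) is a classical forced
torus solution with f ≡ 0 on the core, ‖f‖_{Cᵏ} ≤ M₀, w(0) = V₁) → (P-c: ¬X5a bookkeeping =
GlobalFromNoBlowup) → TorusPortabilityLemma.
RobustTorusScenario ⇐ (S-a: a periodic blow-up with an isolated singular point: collar bounds A,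
energy E) → (S-b: stability of the
mechanism against forcing of rescaled size ≤ C e^{−(2−β−ε)s} supported at rescaled distance ≥ c
e^{βs}) → S; an EQUIVARIANT variant of #2/#4
(forcings sharing the lattice-compatible point symmetries of V₁ about c₀ — the transplant preserves
them) is the first restatement if a
producer needs symmetry protection.

KILL CRITERIA. ¬TorusPortabilityLemma proved (local smoothing holds but some admissible robustly
singular family has only global ℝ³ truncations) kills the
mechanism: close refuted:TorusPortabilityLemma. A theorem "bounded exterior forcing vanishing on a
cube can continue EVERY smooth torus datum
of the admissible class for a time τ(ν,r,k,A,E)" refutes RobustTorusScenario: close. NoBlowup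
(stmt-NavierStokesRegularity-0054) proved ⇒
X5a impossible ⇒ the route is moot (close superseded/moot); X5b refuted without a replacement
selection principle (stmt-0154) ⇒ close, as for
Blowup. LocalSmoothingNearInitialTime refuted AS STATED (e.g. the ∇p clause or x₀-uniformity) ⇒
restate with the printed JS14 shape (repair,
not a kill).

NOT DECOMPOSED YET. The producer side entirely (which scenario, which symmetry, CAP vs modulation) —
other cards/routes (CertifiedBlowup, viscosity-selected-
singularity, dimension-ladder, corkscrew/DSS cards) feed S; the slip/periodic-CYLINDER analogue of
#2 for Hou's axisymmetric container
(Lean has Torus.IsClassicalNSSolutionOn but no Navier-slip cylinder NS notion: definition request);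
the equivariant (symmetric-forcing)
refinement; the bookkeeping inside #2 (radii Q_r ⊂ {χ=1} ⊂ B(c₀,√3 r) ⊂ {u₀ = lift V₁} ⊂ supp u₀ ⊂
B(c₀,2√3 r), cut-offs, the time-parametrised collar
correction, Hölder vs Cᵏ indices, k ↦ k+3 losses); a reusable definition
`TorusRobustlySingularDatum` (inlined for now).

CHEAPEST FALSIFIER. (1) One-line consistency check already run: at t = 0 the transplanted forcing in
the collar contains ∂ₜu(0) = −(u₀·∇)u₀ + νΔu₀ − ∇p(0), whose
only core-dependent piece is ∇p_far(0) with |∇p_far| ≤ C r⁻⁴ ∫_core |V₁|² ≤ 2C E r⁻⁴ — bounded by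
(E,r) however singular the core: passes.
(2) Toy test of S a refuter can run with kit: uₜ = u_xx + u² on the circle, generic single-point
blow-up at (0,T); add forcing of size M
supported in |x| ≥ r from time t₁ on and measure whether blow-up survives for t₁ ↑ T at fixed M
(expected yes for the stable ODE profile,
Merle–Zaag stability; a 'no' would retire the robustness currency). (3) Lookup: any printed theorem
continuing arbitrary smooth periodic
data for a uniform time under exterior control would kill S — none known (it would itself be a
regularity mechanism).

NUMBERS. r ≤ 1/8 (so that the core cube Q_r of half-side r lies in a Euclidean ball B(c₀,√3 r) whose
double B(c₀,2√3 r) still embeds in 𝕋³ = ℝ³/ℤ³: 2√3/8 ≈ 0.433 < 1/2; torus distance = sup of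
coordinate circle distances, so {dist y c₀ < r} is a cube); rescaled size of an
M-bounded physical forcing at log-time s = −log(T−t): M(T−t)^{2−β} for core scale (T−t)^β (Leray β =
½: M e^{−3s/2}); far-field pressure from
the core on the collar: |Dᵐ∇p_far| ≤ C_m E dist^{−4−m}; JS14: T = T(α,γ,M) with α =
sup_{x₀}∫_{B₁(x₀)}|u₀|², Barker–Prange S*(M) ≤ 1/4;
items at open: 7 (3 cruxes, 3 support, 1 assembly).

DEFINITION REQUESTS. (a) `IsSlipCylinderClassicalNSSolutionOn` (Literature/Analysis/FluidPDE):
classical forced NS in {r<1}×(ℝ/Lℤ) with Navier-slip (or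
stress-free) wall condition — needed to type the cylinder analogue of #2/#4 serving CertifiedBlowup
stmt-0271 (Hou arXiv:2107.06509);
filed after open `--for` TorusPortabilityLemma. (b) cite fact wanted: JiaSverak2014 Thms 3.1/3.2 +
the higher-order local bound (arXiv
1204.0529 p.9) as `jia_sverak_2014_local_regularity` (Literature/Analysis/FluidPDE) — discharges #3
by reduction. (c) optional:
`Torus.RobustlySingularDatum ν V₁ c₀ r τ k M` packaging the robustness predicate (inlined in #2/#4
for now).

Novelty: Searches (2026-08-15): `lit frontier NavierStokesRegularity --since 2021` (30 rows: forward
self-similar, non-uniqueness, ε-regularity —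
none on container→ℝ³ transfer of singularities); `lit search` local index unavailable (searchd
down), `--source arxiv|openalex|s2` HTTP 429,
`--source zbmath "localization blow-up single point Navier-Stokes periodic whole space transfer"` 0
hits; `lit galaxy search --star all`
substring ×5 ("periodic blowup implies", "localisation of blow-up", "localization of blowup for
navier", "stability of blowup under small
forcing", "far-field perturbation of a blow-up") 0 hits; reads: Tao arXiv:1108.1165 pp.6-7 and p.40
(Thm 1.20, Remark 81), Jia–Šverák
arXiv:1204.0529 pp.7-9 (Thms 3.1/3.2 = Thms 4/5 of the arXiv text; the all-orders bound in the proof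
of Thm 4.1), Barker–Prange
arXiv:1812.09115 p.2 (Thm 1); the card's novelty audit (refuter-novelty-audit-7: EGM
arXiv:1910.14071, Tao 2013); routes Blowup rev 3,
CertifiedBlowup (stmt-0271 informal), DssFarFieldSlaving (different object: infinite-energy DSS
profile, Gaussian weights).
Nearest prior art found: arXiv:1108.1165 (Tao2011) Remark 81 — periodic singularity ⇒ (CKN annulus +
truncation) a FORCED non-periodic
singular solution with spatially smooth data; Thm 1.20(ii) inhomogeneous H¹ regularity ⇒ periodic
regularity; "unable to obtain the converse
in the inhomogeneous case". arXiv:1910.14071 (Elgindi–Ghoul–Masmoudi): stability of a self-similar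
Euler blow-up ⇒ compactly supported
blow-up (robust  [refs: 1108.1165, 1204.0529, 1812.09115, 1910.14071, Tao2011, JiaSverak2014]

Barriers (technique_class: blowup-construction localisation far-field-perturbation): - technique_class: blowup-construction localisation far-field-perturbation
- Literature.Barriers.NavierStokesRegularity.CriticalNormBlowupNecessity: not fought — the ported
singularity is the container's own, so ‖u(t)‖_{L³(ℝ³)} → ∞ at the blow-up time exactly as
ESS/Seregin require; no L³-bounded ansatz anywhere (S quantifies over genuine blow-ups).
- Literature.Barriers.NavierStokesRegularity.LeraySelfSimilarBlowupExclusion: constrains the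
PRODUCER of S (no exactly self-similar finite-local-energy profile; DSS/Type II/nearly self-similar
only), not the transfer; #2 is rate- and profile-agnostic.
- Literature.Barriers.NavierStokesRegularity.SingularSetDimensionBound: consistent — an isolated
space-time singular point; CKN is in fact USED on the producer side (regular collar around an
isolated singularity, Tao2011 Rmk 81).
- Literature.Barriers.NavierStokesRegularity.AxisymmetricTypeIExclusion: applies only to
axisymmetric producers (rate must be Type II, consistent with Hou's exponents); the torus lemma
carries no symmetry and no rate.
- Literature.Barriers.NavierStokesRegularity.ForcedLerayHopfNonuniqueness: a caution, evaded by
class — the forced torus problem in S is posed for CLASSICAL (smooth) solutions with smooth bounded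
forcing, where uniqueness holds; no rough L¹_t L²_x force, no Leray–Hopf selection issue; the ℝ³
solution is unforced.
- Literature.Barriers.NavierStokesRegularity.NavierStokesInequalitySingularSolution: #3 uses
ε-regularity for genuine (local-energy/s

History (route lifecycle, newest last):
- 2026-08-21T12:09:12Z · DORMANT — reconciler: no traction for 5 d (last activity statement-closed at 2026-08-16T11:42:59Z); parked, not closed — `ledger route dormant route-NavierStokesRegularit (operator:999:2321357)
- 2026-08-27T04:06:02Z · REACTIVATED — reconciler: reactivated — activity item-proof-filed at 2026-08-27T02:20:16Z after parking at 2026-08-21T12:09:12Z (operator:999:1504328)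
- 2026-09-01T22:40:03Z · DORMANT — reconciler: no traction for 5 d (last activity statement-closed at 2026-08-27T21:50:07Z); parked, not closed — `ledger route dormant route-NavierStokesRegularit (operator:999:235495)

sub-problem: NavierStokesRegularity · status: dormant · opened planner-plancard-NavierStokesRegularity-Navie-fb8ed42f-0 2026-08-15T11:09:29Z · rev 3 · ledger route-NavierStokesRegularity-RobustBlowupPortability
GENERATED by the gate from the ledger (D-0016/17). Provers cite these decls: `theorem foo : Summit.NavierStokesRegularity.NavierStokesRegularity.Theses.RobustBlowupPortability.<Decl> := …` in Summits/NavierStokesRegularity/NavierStokesRegularity/Theorems/<Name>.lean.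
-/

namespace Summit.NavierStokesRegularity.NavierStokesRegularity.Theses.RobustBlowupPortability

open scoped BigOperators Topology Manifold Classical MeasureTheory ProbabilityTheory Matrix InnerProductSpace ComplexConjugate ContinuousMap ContDiff
open Filter Set Function TopologicalSpace MeasureTheory

attribute [summit_statement] _root_.NavierStokesRegularity

open Literature.NS

/-- item stmt-NavierStokesRegularity-2926 · crux · rank 4 · open · by planner
why it might fail: Clay (B) may hold; NS blow-up cannot be self-similar/Type I (NRS96, Tsai98) and the rigorous viscous blow-up (MRRS compressible-NS implosion) is only finite-codimension stable: the blow-up set may have empty interior, and adversarial exterior forcing (O(M) harmonic core pressure) exits it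
sources: Fefferman2000, NecasRuzickaSverak1996, Tsai1998, Literature.Barriers.NavierStokesRegularity.LeraySelfSimilarBlowupExclusion, MerleEtAl2022, Hou2022PotentiallySingularNS
[crux] S of the thesis: ∃ ν>0, core cube (c₀, r ≤ 1/8), k, A, E such that ∀ τ>0 ∀ M ∃ a smooth
divergence-free torus datum V₁ (energy ≤ E, |Dʲ lift V₁| ≤ A j off the inner cube {dist < r/2}) that
is (r,τ,k,M)-robustly singular. PRODUCER crux (open-problem difficulty; the exit of every container
construction): a periodic blow-up (¬Clay (B)-type statement) whose late slices v(t₁), t₁ ↑ T, are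
the V₁ — energy ≤ E(0) by the energy equality, collar bounds A by isolatedness of the singular point
(CKN leaves a regular annulus; v and q bounded with all derivatives off the core up to T), and
ROBUSTNESS from stability of the blow-up mechanism modulo symmetries: exterior forcing of physical
size M reaches the core only through a harmonic pressure gradient ∇Δ⁻¹div f and advection over the
vanishing time T−t₁, i.e. as an O((M+E)(T−t)^{2−β}) = O(e^{−(2−β)s}) perturbation in similarity
variables (β = ½ for Leray scaling: e^{−3s/2}). By NS scaling one compactly supported robustly
singular torus datum generates the whole (τ,M)-family. Candidate producers: CertifiedBlowup-type CAP
certificates on 𝕋³ (arXiv:2604.09949, unrefereed), Kida/high-symmetric scenarios,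
viscosity-selected-singularity / dimen -/
@[route_item "route-NavierStokesRegularity-RobustBlowupPortability", crux]
def RobustTorusScenario : Prop :=
  ∃ ν : ℝ, 0 < ν ∧ ∃ (c₀ : UnitAddTorus (Fin 3)) (r : ℝ), 0 < r ∧ r ≤ 1 / 8 ∧ ∃ (k : ℕ) (A : ℕ → ℝ) (E : ℝ), ∀ τ : ℝ, 0 < τ → ∀ M : ℝ, ∃ V₁ : UnitAddTorus (Fin 3) → EuclideanSpace ℝ (Fin 3), Literature.Analysis.FunctionSpaces.Torus.IsSmooth V₁ ∧ Literature.Analysis.FunctionSpaces.Torus.IsDivFree V₁ ∧ Literature.Analysis.FunctionSpaces.Torus.kineticEnergy V₁ ≤ E ∧ (∀ (j : ℕ) (x : EuclideanSpace ℝ (Fin 3)), r / 2 ≤ dist (Literature.Analysis.FunctionSpaces.Torus.proj x) c₀ → ‖iteratedFDeriv ℝ j (Literature.Analysis.FunctionSpaces.Torus.lift V₁) x‖ ≤ A j) ∧ ∀ (f w : ℝ → UnitAddTorus (Fin 3) → EuclideanSpace ℝ (Fin 3)) (q : ℝ → UnitAddTorus (Fin 3) → ℝ), Literature.Analysis.FunctionSpaces.Torus.IsClassicalNSSolutionOn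 (Set.Icc 0 τ) ν f w q → w 0 = V₁ → (∀ t ∈ Set.Icc 0 τ, Literature.Analysis.FunctionSpaces.Torus.IsSmooth (f t)) → (∀ t ∈ Set.Icc 0 τ, ∀ y : UnitAddTorus (Fin 3), dist y c₀ < r → f t y = 0) → (∀ t ∈ Set.Icc 0 τ, ∀ j ≤ k, ∀ x : EuclideanSpace ℝ (Fin 3), ‖iteratedFDeriv ℝ j (Literature.Analysis.FunctionSpaces.Torus.lift (f t)) x‖ ≤ M) → False

/-- item stmt-NavierStokesRegularity-2924 · support · rank 2 · open · by planner
why it might fail: Collar forcing must be bounded by (ν,r,k,A,E) alone: uses ∇p_far ≲ E r⁻⁴ (energy only) and SPATIAL Cᵏ bounds only (∂ₜ∇p_far would need ∫|u|³, unbounded near a blow-up); dies if exact datum matching w(0)=V₁ or the t↓0-uniform collar bounds cannot be arranged.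
sources: Tao2011, JiaSverak2014, Galdi2011, ElgindiGhoulMasmoudi2021
[crux] (local smoothing near the initial time, = the statement of #3) → for all ν>0, core cube (c₀,
r ≤ 1/8), order k, collar bounds A and energy E there are a horizon τ>0 and a forcing size M such
that every smooth divergence-free torus datum V₁ with energy ≤ E and derivatives ≤ A j off the inner
cube which is (r,τ,k,M)-robustly singular yields X5a (a maximal classical Leray–Hopf solution on
ℝ³×[0,T), T<∞, from a rapidly decaying datum). Proof plan: contrapositive via support
GlobalFromNoBlowup (¬X5a ⇒ global classical solutions on closed slabs from the C_c^∞ truncation u₀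
of the lift of V₁, support DivFreeTruncation), collar bounds from the hypothesis (#3) with (A',E')
computed from (A,E,r), transplant w = χu♭ + (1−χ)V₁ + b (b a divergence-free collar correction of
∇χ·(u♭−V₁), vanishing at t=0), pressure χ̃p♭: forcing f := ∂ₜw + (w·∇)w − νΔw + ∇(χ̃p♭) is ≡ 0 on {χ
= 1} ⊇ core cube and Cᵏ-bounded by M₀(ν,r,k,A,E) on [0,τ]; w(0) = V₁; contradiction with robust
singularity. Card items (P2) far-field bookkeeping and (P3) glue live here; (R) is the hypothesis.
[deps: LocalSmoothingNearInitialTime, GlobalFromNoBlowup, DivFreeTruncation] [difficulty: L] -/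
@[route_item "route-NavierStokesRegularity-RobustBlowupPortability", crux]
def TorusPortabilityLemma : Prop :=
  (∀ ν : ℝ, 0 < ν → ∀ ρ : ℝ, 0 < ρ → ∀ (k : ℕ) (A : ℕ → ℝ) (E : ℝ), ∃ τ : ℝ, 0 < τ ∧ ∃ M : ℝ, ∀ (T' : ℝ) (x₀ : EuclideanSpace ℝ (Fin 3)) (u : ℝ → EuclideanSpace ℝ (Fin 3) → EuclideanSpace ℝ (Fin 3)) (p : ℝ → EuclideanSpace ℝ (Fin 3) → ℝ), 0 < T' → Literature.Analysis.FluidPDE.IsClassicalNSSolutionOn (Set.Icc 0 T') ν 0 u p → Literature.Analysis.FluidPDE.IsLerayHopfOn T' ν 0 (u 0) u → Literature.Analysis.FluidPDE.HasRapidSpatialDecay (u 0) → (∫⁻ x, ‖u 0 x‖ₑ ^ 2) ≤ ENNReal.ofReal E → (∀ (j : ℕ) (x : EuclideanSpace ℝ (Fin 3)), dist x x₀ < 2 * ρ → ‖iteratedFDeriv ℝ j (u 0) x‖ ≤ A j) → ∀ t ∈ Set.Icc 0 (min τ T'), ∀ j ≤ k, ∀ x : EuclideanSpace ℝ (Fin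 3), dist x x₀ ≤ ρ → ‖iteratedFDeriv ℝ j (u t) x‖ ≤ M ∧ ‖iteratedFDeriv ℝ j (fderiv ℝ (p t)) x‖ ≤ M) → ∀ ν : ℝ, 0 < ν → ∀ (c₀ : UnitAddTorus (Fin 3)) (r : ℝ), 0 < r → r ≤ 1 / 8 → ∀ (k : ℕ) (A : ℕ → ℝ) (E : ℝ), ∃ τ : ℝ, 0 < τ ∧ ∃ M : ℝ, ∀ V₁ : UnitAddTorus (Fin 3) → EuclideanSpace ℝ (Fin 3), Literature.Analysis.FunctionSpaces.Torus.IsSmooth V₁ → Literature.Analysis.FunctionSpaces.Torus.IsDivFree V₁ → Literature.Analysis.FunctionSpaces.Torus.kineticEnergy V₁ ≤ E → (∀ (j : ℕ) (x : EuclideanSpace ℝ (Fin 3)), r / 2 ≤ dist (Literature.Analysis.FunctionSpaces.Torus.proj x) c₀ → ‖iteratedFDeriv ℝ j (Literature.Analysis.FunctionSpaces.Torus.lift V₁) x‖ ≤ A j) → (∀ (f w : ℝ → UnitAddTorus (Fin 3) → EuclideanSpace ℝ (Fin 3)) (q : ℝ → UnitAddTorus (Fin 3) → ℝ), Literature.Analysis.FunctionSpaces.Torus.IsClassicalNSSolutionOn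 (Set.Icc 0 τ) ν f w q → w 0 = V₁ → (∀ t ∈ Set.Icc 0 τ, Literature.Analysis.FunctionSpaces.Torus.IsSmooth (f t)) → (∀ t ∈ Set.Icc 0 τ, ∀ y : UnitAddTorus (Fin 3), dist y c₀ < r → f t y = 0) → (∀ t ∈ Set.Icc 0 τ, ∀ j ≤ k, ∀ x : EuclideanSpace ℝ (Fin 3), ‖iteratedFDeriv ℝ j (Literature.Analysis.FunctionSpaces.Torus.lift (f t)) x‖ ≤ M) → False) → ∃ ν : ℝ, 0 < ν ∧ ∃ T : ℝ, 0 < T ∧ ∃ (u : ℝ → EuclideanSpace ℝ (Fin 3) → EuclideanSpace ℝ (Fin 3)) (p : ℝ → EuclideanSpace ℝ (Fin 3) → ℝ), Literature.Analysis.FluidPDE.IsMaximalSmoothSolution ν 0 u p T ∧ Literature.Analysis.FluidPDE.IsLerayHopfOn T ν 0 (u 0) u ∧ Literature.Analysis.FluidPDE.HasRapidSpatialDecay (u 0)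

/-- item stmt-NavierStokesRegularity-2925 · support · rank 3 · open · by planner
why it might fail: Printed at Hölder level (JS14 Thm 3.2); the all-orders bound up to t=0 is only claimed inside a proof ('simple bootstrapping', arXiv:1204.0529 p.9); we also need constants uniform in x₀ depending on the datum only via (A,E), general ν, ρ and the ∇p clause — a gap in print rather than in truth.
sources: JiaSverak2014, Literature.Analysis.FluidPDE.jia_sverak_2014_local_higher_regularity, Literature.Analysis.FluidPDE.kato_isLocalLeraySolutionOn, KangMiuraTsai2021, BarkerPrange2020
[crux] LOCAL-IN-SPACE REGULARITY NEAR THE INITIAL TIME, higher-order form (Jia–Šverák): for ν>0,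
radius ρ, order k, local bounds A : ℕ → ℝ and energy E there are τ>0 and M such that every classical
solution (u,p) of unforced NS on ℝ³×[0,T'], Leray–Hopf from its rapidly decaying datum u(0), with
∫|u(0)|² ≤ E and |Dʲu(0)| ≤ A j on B(x₀,2ρ) for all j, satisfies |Dʲu(t,x)| ≤ M and |Dʲ∇p(t,x)| ≤ M
for j ≤ k, x ∈ B(x₀,ρ), t ∈ [0, min(τ,T')] — constants uniform in x₀ and in the solution. In print:
JS14 Thm 3.2 (C^γ_par up to t=0, T = T(α,γ,M)) and, for all derivatives incl. one ∂ₜ, the bound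
‖∂ₜ∂ₓ^α u‖_{L∞(B_{1/8}(x₀)×[0,T₂])} ≤ C(α,u₀) asserted in the proof of Thm 4.1 (arXiv text p. 9) for
local Leray solutions with u₀ smooth in B₄(x₀); ν, ρ by scaling; the ∇p clause from ∇p = −∂ₜu −
(u·∇)u + νΔu or from the near/far split of the normalised pressure
(tao_pressure_normalisation_holds, proved in-tree) with |Dᵐ∇p_far| ≲ E·dist^{-4-m}. Expected
discharge: vendor JS14 Thms 3.1/3.2 (+ the bootstrapped higher-order estimate) as a named fact (cite
item filed) and reduce; or prove along JS14 using the in-tree local-Leray/CKN facts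
(jia_sverak_2013_lemma_2, CKN files). [difficulty: L] -/
@[route_item "route-NavierStokesRegularity-RobustBlowupPortability", crux]
def LocalSmoothingNearInitialTime : Prop :=
  ∀ ν : ℝ, 0 < ν → ∀ ρ : ℝ, 0 < ρ → ∀ (k : ℕ) (A : ℕ → ℝ) (E : ℝ), ∃ τ : ℝ, 0 < τ ∧ ∃ M : ℝ, ∀ (T' : ℝ) (x₀ : EuclideanSpace ℝ (Fin 3)) (u : ℝ → EuclideanSpace ℝ (Fin 3) → EuclideanSpace ℝ (Fin 3)) (p : ℝ → EuclideanSpace ℝ (Fin 3) → ℝ), 0 < T' → Literature.Analysis.FluidPDE.IsClassicalNSSolutionOn (Set.Icc 0 T') ν 0 u p → Literature.Analysis.FluidPDE.IsLerayHopfOn T' ν 0 (u 0) u → Literature.Analysis.FluidPDE.HasRapidSpatialDecay (u 0) → (∫⁻ x, ‖u 0 x‖ₑ ^ 2) ≤ ENNReal.ofReal E → (∀ (j : ℕ) (x : EuclideanSpace ℝ (Fin 3)), dist x x₀ < 2 * ρ → ‖iteratedFDeriv ℝ j (u 0) x‖ ≤ A j) → ∀ t ∈ Set.Icc 0 (min τ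 T'), ∀ j ≤ k, ∀ x : EuclideanSpace ℝ (Fin 3), dist x x₀ ≤ ρ → ‖iteratedFDeriv ℝ j (u t) x‖ ≤ M ∧ ‖iteratedFDeriv ℝ j (fderiv ℝ (p t)) x‖ ≤ M

/-- item stmt-NavierStokesRegularity-0153 · support · rank 9 · closed · proved by Summit.NavierStokesRegularity.NavierStokesRegularity.Theorems.adiabaticEddy_clayUniqueness_proof @ bd26efe366a2 (prover) · by planner
sources: Fefferman2000, arXiv:1108.1165 (Tao2011 Lemma 4.1 and Cor 11.4), Prodi1959, Serrin1963
Fefferman's class (A) = jointly C^∞ on ℝ³×[0,∞) + sup_t ∫|u|² < ∞; no energy inequality, no decay of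
∇u, no integrability in LPS scales is assumed. Claim: such (u,p) coincides on [0,T) with any
Leray–Hopf classical solution v from the same rapidly decaying datum. Expected route: smoothness +
bounded energy ⇒ u is a distributional solution with locally finite dissipation?? (NOT automatic:
∫∫|∇u|² may be infinite) — this is exactly the delicate point; alternatives: Liouville-type control
of the pressure (p harmonic part must be affine ⇒ excluded by bounded energy), then local energy
inequality, then weak–strong uniqueness (Prodi 1959, Serrin 1963) against v which is in every LPS
class on compacts of [0,T). [sources: Prodi1959, Serrin1963, Fefferman2000, LemarieRieusset2002,
RobinsonRodrigoSadowski2016] -/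
@[route_item "route-NavierStokesRegularity-RobustBlowupPortability", crux]
def ClayUniqueness : Prop :=
  ∀ ν : ℝ, 0 < ν → ∀ (u₀ : EuclideanSpace ℝ (Fin 3) → EuclideanSpace ℝ (Fin 3)), Literature.Analysis.FluidPDE.HasRapidSpatialDecay u₀ → ∀ (u v : ℝ → EuclideanSpace ℝ (Fin 3) → EuclideanSpace ℝ (Fin 3)) (p q : ℝ → EuclideanSpace ℝ (Fin 3) → ℝ) (T : ℝ), 0 < T → Literature.Analysis.FluidPDE.IsSmoothOnHalfSpace u → Literature.Analysis.FluidPDE.IsSmoothOnHalfSpace p → Literature.Analysis.FluidPDE.IsNavierStokesSolution ν 0 u₀ u p → Literature.Analysis.FluidPDE.HasBoundedEnergy u → Literature.Analysis.FluidPDE.IsClassicalNSSolutionOn (Set.Ico 0 T) ν 0 v q → Literature.Analysis.FluidPDE.IsLerayHopfOn T ν 0 u₀ v → v 0 = u₀ → ∀ t ∈ Set.Ico 0 T, u t = v t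

/-- `ClayUniqueness` holds: proved by `Summit.NavierStokesRegularity.NavierStokesRegularity.Theorems.adiabaticEddy_clayUniqueness_proof` @ bd26efe366a2. -/
theorem ClayUniqueness_holds : ClayUniqueness := _root_.Summit.NavierStokesRegularity.NavierStokesRegularity.Theorems.adiabaticEddy_clayUniqueness_proof

/-- item stmt-NavierStokesRegularity-2927 · support · rank 9 · closed · proved by Summit.NavierStokesRegularity.NavierStokesRegularity.Theorems.robustBlowupPortability_globalFromNoBlowup_proof (prover) · by planner
sources: arXiv:1108.1165 (Tao2011 Thm 5.4 and Cor 11.1), Leray1934, BealeKatoMajda1984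
[support] ¬X5a ⇒ for every ν>0, every smooth divergence-free rapidly decaying datum u₀ on ℝ³ and
every T>0 there is a classical solution (u,p) on the CLOSED slab [0,T], Leray–Hopf from u₀, u(0) =
u₀. Continuation bookkeeping: local classical existence on closed slabs
(tao2011_smooth_local_existence_holds / Fluid.local_classical_lerayHopf, proved in-tree),
weak–strong uniqueness (serrin_weak_strong_uniqueness_holds) to make extensions compatible, gluing
(IsClassicalNSSolutionOn.glue), and ¬X5a = every classical LH solution from a decaying datum extends
past its endpoint (cf. stmt-NavierStokesRegularity-0730: X5a ↔ ¬NoBlowup); a sup argument gives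
[0,T]. [difficulty: M] -/
@[route_item "route-NavierStokesRegularity-RobustBlowupPortability"]
def GlobalFromNoBlowup : Prop :=
  (¬ ∃ ν : ℝ, 0 < ν ∧ ∃ T : ℝ, 0 < T ∧ ∃ (u : ℝ → EuclideanSpace ℝ (Fin 3) → EuclideanSpace ℝ (Fin 3)) (p : ℝ → EuclideanSpace ℝ (Fin 3) → ℝ), Literature.Analysis.FluidPDE.IsMaximalSmoothSolution ν 0 u p T ∧ Literature.Analysis.FluidPDE.IsLerayHopfOn T ν 0 (u 0) u ∧ Literature.Analysis.FluidPDE.HasRapidSpatialDecay (u 0)) → ∀ ν : ℝ, 0 < ν → ∀ u₀ : EuclideanSpace ℝ (Fin 3) → EuclideanSpace ℝ (Fin 3), ContDiff ℝ ∞ u₀ → Literature.Analysis.FluidPDE.VectorCalculus.IsDivFree u₀ → Literature.Analysis.FluidPDE.HasRapidSpatialDecay u₀ → ∀ T : ℝ, 0 < T → ∃ (u : ℝ → EuclideanSpace ℝ (Fin 3) → EuclideanSpace ℝ (Fin 3)) (p : ℝ → EuclideanSpace ℝ (Fin 3) → ℝ), Literature.Analysis.FluidPDE.IsClassicalNSSolutionOn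 (Set.Icc 0 T) ν 0 u p ∧ Literature.Analysis.FluidPDE.IsLerayHopfOn T ν 0 u₀ u ∧ u 0 = u₀

-- `GlobalFromNoBlowup` holds: proved by `Summit.NavierStokesRegularity.NavierStokesRegularity.Theorems.robustBlowupPortability_globalFromNoBlowup_proof` (its module imports this route file, so no `_holds` link can be stated here).

/-- item stmt-NavierStokesRegularity-2928 · support · rank 9 · closed · proved by Summit.NavierStokesRegularity.NavierStokesRegularity.Theorems.robustBlowupPortability_divFreeTruncation_proof (prover) · by planner
sources: Galdi2011 III.3 (Bogovskii 1979), arXiv:1204.0529 (footnote to Thm 3.1)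
[support] Divergence-free truncation with collar control (Bogovskiĭ / cut vector potential): for ρ>0
and bounds A, E there is C : ℕ → ℝ such that every smooth divergence-free V on ℝ³ with
∫_{B(x₀,2ρ)}|V|² ≤ E and |DʲV| ≤ A j on the shell ρ/2 ≤ |x−x₀| ≤ 2ρ admits a smooth divergence-free
u₀ with u₀ = V on B̄(x₀,ρ), u₀ = 0 off B(x₀,2ρ), and |Dʲu₀| ≤ C j for |x−x₀| ≥ ρ. (u₀ = χV −
Bog[∇χ·V] on the annulus, compatibility ∫∇χ·V = 0 from div V = 0; Galdi III.3; JS14 footnote to Thm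
3.1. No Bogovskiĭ operator is in the tree yet; a cut vector-potential construction, where E enters,
is an alternative.) Used by #2 for the ℝ³ datum and, with a time parameter, for the collar
correction b. [difficulty: M] -/
@[route_item "route-NavierStokesRegularity-RobustBlowupPortability"]
def DivFreeTruncation : Prop :=
  ∀ ρ : ℝ, 0 < ρ → ∀ (A : ℕ → ℝ) (E : ℝ), ∃ C : ℕ → ℝ, ∀ (x₀ : EuclideanSpace ℝ (Fin 3)) (V : EuclideanSpace ℝ (Fin 3) → EuclideanSpace ℝ (Fin 3)), ContDiff ℝ ∞ V → Literature.Analysis.FluidPDE.VectorCalculus.IsDivFree V → (∫ x in Metric.ball x₀ (2 * ρ), ‖V x‖ ^ 2) ≤ E → (∀ (j : ℕ) (x : EuclideanSpace ℝ (Fin 3)), ρ / 2 ≤ dist x x₀ → dist x x₀ ≤ 2 * ρ → ‖iteratedFDeriv ℝ j V x‖ ≤ A j) → ∃ u₀ : EuclideanSpace ℝ (Fin 3) → EuclideanSpace ℝ (Fin 3), ContDiff ℝ ∞ u₀ ∧ Literature.Analysis.FluidPDE.VectorCalculus.IsDivFree u₀ ∧ (∀ x, dist x x₀ ≤ ρ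 → u₀ x = V x) ∧ (∀ x, 2 * ρ ≤ dist x x₀ → u₀ x = 0) ∧ (∀ (j : ℕ) (x : EuclideanSpace ℝ (Fin 3)), ρ ≤ dist x x₀ → ‖iteratedFDeriv ℝ j u₀ x‖ ≤ C j)

-- `DivFreeTruncation` holds: proved by `Summit.NavierStokesRegularity.NavierStokesRegularity.Theorems.robustBlowupPortability_divFreeTruncation_proof` (its module imports this route file, so no `_holds` link can be stated here).

/-- item stmt-NavierStokesRegularity-2929 · assembly · rank 1 · closed · proved by Summit.NavierStokesRegularity.NavierStokesRegularity.Theorems.robustBlowupPortability_assembly_proof (prover) · by planner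
sources: Fefferman2000, BealeKatoMajda1984
[assembly] RobustTorusScenario → TorusPortabilityLemma → LocalSmoothingNearInitialTime →
ClayUniqueness → ¬NavierStokesRegularity -/
@[route_item "route-NavierStokesRegularity-RobustBlowupPortability"]
def Assembly : Prop :=
  RobustTorusScenario → TorusPortabilityLemma → LocalSmoothingNearInitialTime → ClayUniqueness → ¬ NavierStokesRegularity

-- `Assembly` holds: proved by `Summit.NavierStokesRegularity.NavierStokesRegularity.Theorems.robustBlowupPortability_assembly_proof` (its module imports this route file, so no `_holds` link can be stated here).

/-! D-0027 §2.1 — DECIDING THEOREM (planner-authored via `route open/edit --closes-file`; by planner-rbadge-NavierStokesRegularity-RobustBl-38bf8766-g2-0 2026-08-15T16:19:10Z):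
its hypotheses are this route's items and its conclusion the sub-problem Statement (glue_lint), and it elaborates with this file. -/

/-- Deciding theorem (D-0027 §2.1) of route `RobustBlowupPortability`, NEGATIVE side: the robust
torus scenario `RobustTorusScenario` (S), the portability bridge `TorusPortabilityLemma` (#2), local
smoothing near the initial time `LocalSmoothingNearInitialTime` (#3) and Clay-class uniqueness
`ClayUniqueness` (X5b, stmt-NavierStokesRegularity-0153) refute Clay statement (A)
`NavierStokesRegularity`. Pure logic, self-contained in this file's imports: S gives
(ν, c₀, r, k, A, E); #2 applied to #3 gives a horizon τ and a forcing size M; S at (τ, M) gives an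
admissible (r,τ,k,M)-robustly singular torus datum V₁; #2 turns it into X5a = a maximal classical
Leray–Hopf solution (u, p) on ℝ³ × [0, T), T < ∞, from a rapidly decaying datum; then the argument
of the proved glue `Literature.NS.blowup_assembly` (Theorems/BlowupAssembly.lean,
stmt-NavierStokesRegularity-0151) inline: (A) applied to the datum `u 0` (smooth and divergence free
as a slice of a classical solution, rapidly decaying by X5a) gives a global Clay-class solution
`(u', p')`; `ClayUniqueness` identifies `u'` with `u` on `[0, T)`; `(u', p')` is a classical
solution on `Ici 0` (the wave-0 bridge, field for field), and its restriction to `Ico 0 (T + 1)` is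
a smooth extension of `u` past `T`, contradicting maximality (Beale–Kato–Majda 1984, §1). The
support items `GlobalFromNoBlowup` and `DivFreeTruncation` feed the proof of #2 and are deliberately
not hypotheses here. -/
@[closes "route-NavierStokesRegularity-RobustBlowupPortability"] theorem closes (hS : RobustTorusScenario) (hP : TorusPortabilityLemma)
    (hL : LocalSmoothingNearInitialTime) (hU : ClayUniqueness) : ¬ NavierStokesRegularity := by
  intro hA
  obtain ⟨ν, hν, c₀, r, hr, hr8, k, A, E, hfam⟩ := hS
  obtain ⟨τ, hτ, M, hM⟩ := hP hL ν hν c₀ r hr hr8 k A E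
  obtain ⟨V₁, hsm, hdiv, hE, hcol, hrob⟩ := hfam τ hτ M
  obtain ⟨ν', hν', T, hT, u, p, ⟨hcl, hmax⟩, hLH, hdec⟩ := hM V₁ hsm hdiv hE hcol hrob
  have h0 : (0 : ℝ) ∈ Set.Ico 0 T := ⟨le_rfl, hT⟩
  obtain ⟨u', p', hu', hp', hns, hbe⟩ :=
    hA ν' hν' (u 0) (hcl.contDiff_velocity h0) (hcl.divFree 0 h0) hdec
  have heq : ∀ t ∈ Set.Ico 0 T, u' t = u t :=
    hU ν' hν' (u 0) hdec u' u p' p T hT hu' hp' hns hbe hcl hLH rfl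
  have hcl' : Literature.Analysis.FluidPDE.IsClassicalNSSolutionOn (Set.Ici 0) ν' 0 u' p' :=
    ⟨hu', hp', fun t ht x => hns.momentum t ht x, fun t ht => hns.divFree t ht⟩
  refine hmax ⟨T + 1, by linarith, u', p', ?_, heq⟩
  exact hcl'.mono (fun t ht => ht.1) (uniqueDiffOn_Ico 0 (T + 1))

end Summit.NavierStokesRegularity.NavierStokesRegularity.Theses.RobustBlowupPortability
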